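import Mathlib
import Summits.Parity.GeneralizedHardyLittlewood.Theorems.PrimeGapTorusCapPart1
import HarnessLib

/-!
# Prime-gap limit points, the torus cap (cell parity-ideate, p4 ROUND-12) — part 2/8 (`upPiece_subset_D3` … `ConjLinZAt`)

Source: `HOME/parity-ideate-p4/round12/Sketch16.lean` (sha16 e5770481db81479a, 7 278 lines, farm rc 0 / 0 sorry /
axioms std-3; namespace `ParityIdeateP4R8`), cut by parity-ideate-lit g32 (`ports/toruscap/build_toruscap.py`) to the
dependency cone (143 declarations) of the eight headline declarations `torusCap_iff`, `torusCapBrauer_iff`,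
`torusCap_half`, `cb1_holds`, `conjHalfStrict_holds`, `NearAP.delannoyNonVanishing_holds`, `capGivesCoverage`,
`residueCoverage_half_of_literature`, in a chain of 8 files of ≤ 400 lines (Theorems-side lint); statements byte-identical
to the source except: `NearAP.P0/P1/P2` are `abbrev` (source: `def` + three `Decidable` instances, dropped per the typing
lint), examples and `decide` rungs outside the cone dropped, namespace `ParityIdeateP4R8` ↦ `Summit.Parity.GeneralizedHardyLittlewood.Theorems.PrimeGapTorusCap`.
Non-Mathlib inputs: `Literature.Combinatorics.Additive.ErdosHeilbronn` (combinatorial Nullstellensatz),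
`Literature.NumberTheory.Sieve.PrimeGapLimitPoints` (`primeGapLimitSet`, `HasPointProperty`, the NAMED fact
`Merikoski2020_theorem1`, used hypothesis-style, never asserted).  No `sorry`, no new axioms, no `instance`, no notation.
Cell-original mathematics (FRONTIER formalisation; nothing here bears on the parity problem beyond the typed statements):
CONJECTURE C of the cell = every measurable `perℤ`-periodic four-point-free `U ⊆ ℝ` has `μ(U ∩ [0,per)) ≤ per/2`,
sharp (mid arc); pay-off: residues of the prime-gap limit-point set `𝓛` modulo `λ` cover ≥ half of `[0, λ)` for every
`λ > 0`, given Merikoski's four-point theorem.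
-/

namespace Summit.Parity.GeneralizedHardyLittlewood.Theorems.PrimeGapTorusCap
open MeasureTheory Set Filter Topology NearAP
section Residues
variable {N : ℕ} [NeZero N]

/-- (cell parity-ideate p4, Sketch16 — helper; statement verbatim) -/
theorem upPiece_subset_D3 {U : Set ℝ} (hU : MeasurableSet U) (hP : Periodic1 U) {η : ℝ}
    (hη0 : 0 < η) {S : Finset (ZMod N)}
    (hS : ∀ s ∈ S, CellDense U N η (s.val : ℤ)) {j : ZMod N} (hj : P1 S j ∨ P2 S j ∨ P0 S (j + 1)) :
    upPiece N η j ⊆ D3 U := by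
  have hN : 0 < N := Nat.pos_of_ne_zero (NeZero.ne N)
  have hN' : (0 : ℝ) < N := Nat.cast_pos.2 hN
  intro d hd
  simp only [upPiece, Set.mem_Ioo, div_lt_iff₀ hN', lt_div_iff₀ hN'] at hd
  obtain ⟨hd1, hd2⟩ := hd
  have dens : ∀ (s : ZMod N) (c z : ℤ), z = (s.val : ℤ) + c → s + (c : ZMod N) ∈ S → CellDense U N η z := by
    rintro s c z rfl hsc
    exact (cellDense_iff_of_cast_eq hP hN η (cast_val_add s c)).2 (hS _ hsc)
  have hv : ((j.val : ℕ) : ZMod N) = j := ZMod.natCast_zmod_val j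
  rcases hj with ⟨s, hs, h1, h2⟩ | ⟨s, hs, h1, h2⟩ | ⟨s, hs, h1, h2⟩
  · have hdeq : d = (((j.val : ℤ) : ℝ) + (d * N - j.val)) / N := by
      push_cast
      field_simp
      ring
    rw [hdeq]
    exact D3_of_P1cells hU hN hη0 (hS s hs)
      (dens s (j.val : ℤ) _ (by ring) (by push_cast; rw [hv]; exact h1))
      (dens s (2 * (j.val : ℤ) + 1) _ (by ring) (by push_cast; rw [hv, ← add_assoc]; exact h2))
      (by linarith) (by linarith)
  · have hdeq : d = (((j.val : ℤ) : ℝ) + (d * N - j.val)) / N := by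
      push_cast
      field_simp
      ring
    rw [hdeq]
    exact D3_of_P2cells hU hN hη0 (hS s hs)
      (dens s ((j.val : ℤ) + 1) _ (by ring) (by push_cast; rw [hv, ← add_assoc]; exact h1))
      (dens s (2 * (j.val : ℤ) + 1) _ (by ring) (by push_cast; rw [hv, ← add_assoc]; exact h2))
      (by linarith) (by linarith)
  · -- a genuine AP one cell up, read with a negative offset θ' = dN - (j.val+1)
    have hdeq : d = ((((j.val : ℤ) + 1 : ℤ) : ℝ) + (d * N - j.val - 1)) / N := by
      push_cast
      field_simp
      ring
    rw [hdeq]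
    exact D3_of_P0cells hU hN hη0 (hS s hs)
      (dens s ((j.val : ℤ) + 1) _ (by ring) (by push_cast; rw [hv]; exact h1))
      (dens s (2 * (j.val : ℤ) + 2) _ (by ring) (by
        have e2 : s + ((2 * (j.val : ℤ) + 2 : ℤ) : ZMod N) = s + 2 * (j + 1) := by
          push_cast
          rw [hv]
          ring
        rw [e2]
        exact h2))
      (abs_le.2 ⟨by linarith, by linarith⟩)

/-- (cell parity-ideate p4, Sketch16 — helper; statement verbatim) -/
theorem lowPiece_subset_Ico {η : ℝ} (hη0 : 0 < η) (j : ZMod N) : lowPiece N η j ⊆ Set.Ico (0 : ℝ) 1 := by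
  have hN : 0 < N := Nat.pos_of_ne_zero (NeZero.ne N)
  have hN' : (0 : ℝ) < N := Nat.cast_pos.2 hN
  have hjN : (j.val : ℝ) + 1 ≤ N := by exact_mod_cast ZMod.val_lt j
  intro d hd
  simp only [lowPiece, Set.mem_Ioo, div_lt_iff₀ hN', lt_div_iff₀ hN'] at hd
  have h0 : (0 : ℝ) ≤ j.val := Nat.cast_nonneg _
  constructor
  · nlinarith [hd.1]
  · nlinarith [hd.2]

/-- (cell parity-ideate p4, Sketch16 — helper; statement verbatim) -/
theorem upPiece_subset_Ico {η : ℝ} (hη0 : 0 < η) (j : ZMod N) : upPiece N η j ⊆ Set.Ico (0 : ℝ) 1 := by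
  have hN : 0 < N := Nat.pos_of_ne_zero (NeZero.ne N)
  have hN' : (0 : ℝ) < N := Nat.cast_pos.2 hN
  have hjN : (j.val : ℝ) + 1 ≤ N := by exact_mod_cast ZMod.val_lt j
  intro d hd
  simp only [upPiece, Set.mem_Ioo, div_lt_iff₀ hN', lt_div_iff₀ hN'] at hd
  have h0 : (0 : ℝ) ≤ j.val := Nat.cast_nonneg _
  constructor
  · nlinarith [hd.1]
  · nlinarith [hd.2]

omit [NeZero N] in
/-- (cell parity-ideate p4, Sketch16 — helper; statement verbatim) -/
theorem volume_lowPiece (η : ℝ) (j : ZMod N) :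
    volume (lowPiece N η j) = ENNReal.ofReal ((1 / 2 - 5 * η) / N) := by
  rw [lowPiece, Real.volume_Ioo]
  congr 1
  rw [div_sub_div_same]
  congr 1
  ring

omit [NeZero N] in
/-- (cell parity-ideate p4, Sketch16 — helper; statement verbatim) -/
theorem volume_upPiece (η : ℝ) (j : ZMod N) :
    volume (upPiece N η j) = ENNReal.ofReal ((1 / 2 - 5 * η) / N) := by
  rw [upPiece, Real.volume_Ioo]
  congr 1
  rw [div_sub_div_same]
  congr 1
  ring

/-- (cell parity-ideate p4, Sketch16 — helper; statement verbatim) -/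
theorem val_succ_le_of_ne {i j : ZMod N} (h : i ≠ j) : (i.val : ℝ) + 1 ≤ j.val ∨ (j.val : ℝ) + 1 ≤ i.val := by
  have hv : i.val ≠ j.val := fun e => h (ZMod.val_injective N e)
  rcases Nat.lt_or_gt_of_ne hv with hlt | hlt
  · left
    exact_mod_cast hlt
  · right
    exact_mod_cast hlt

/-- **SOUNDNESS OF THE BLOCK COUNT WITH MARGINS**: if every residue in `S` indexes an `η`-dense cell of the measurable
1-periodic set `U`, then `μ(D₃U ∩ [0,1)) ≥ (|D₃⁺S| + |D₃⁻S|)·(½ - 5η)/N`. -/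
theorem count_mul_le_volume_D3 {U : Set ℝ} (hU : MeasurableSet U) (hP : Periodic1 U) {η : ℝ}
    (hη0 : 0 < η) (S : Finset (ZMod N)) (hS : ∀ s ∈ S, CellDense U N η (s.val : ℤ)) :
    ((d3plusCard S + d3minusCard S : ℕ) : ENNReal) * ENNReal.ofReal ((1 / 2 - 5 * η) / N) ≤
      volume (D3 U ∩ Set.Ico (0 : ℝ) 1) := by
  have hN : 0 < N := Nat.pos_of_ne_zero (NeZero.ne N)
  have hN' : (0 : ℝ) < N := Nat.cast_pos.2 hN
  set Pl : Finset (ZMod N) := Finset.univ.filter fun j => P0 S j ∨ P1 S j ∨ P2 S j with hPl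
  set Mi : Finset (ZMod N) := Finset.univ.filter fun j => P1 S j ∨ P2 S j ∨ P0 S (j + 1) with hMi
  have hcPl : Pl.card = d3plusCard S := rfl
  have hcMi : Mi.card = d3minusCard S := rfl
  have hdisjL : (Pl : Set (ZMod N)).PairwiseDisjoint (lowPiece N η) := by
    intro i _ j _ hij
    rcases val_succ_le_of_ne hij with h | h
    · exact Ioo_disjoint_of_le (div_le_div_of_nonneg_right (by linarith) hN'.le)
    · exact (Ioo_disjoint_of_le (div_le_div_of_nonneg_right (by linarith) hN'.le)).symm
  have hdisjU : (Mi : Set (ZMod N)).PairwiseDisjoint (upPiece N η) := by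
    intro i _ j _ hij
    rcases val_succ_le_of_ne hij with h | h
    · exact Ioo_disjoint_of_le (div_le_div_of_nonneg_right (by linarith) hN'.le)
    · exact (Ioo_disjoint_of_le (div_le_div_of_nonneg_right (by linarith) hN'.le)).symm
  have hdisj : Disjoint (⋃ j ∈ Pl, lowPiece N η j) (⋃ j ∈ Mi, upPiece N η j) := by
    rw [Set.disjoint_iUnion₂_left]
    intro i _
    rw [Set.disjoint_iUnion₂_right]
    intro j _
    by_cases hij : i = j
    · subst hij
      exact Ioo_disjoint_of_le (div_le_div_of_nonneg_right (by linarith) hN'.le)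
    · rcases val_succ_le_of_ne hij with h | h
      · exact Ioo_disjoint_of_le (div_le_div_of_nonneg_right (by linarith) hN'.le)
      · exact (Ioo_disjoint_of_le (div_le_div_of_nonneg_right (by linarith) hN'.le)).symm
  have hsub : (⋃ j ∈ Pl, lowPiece N η j) ∪ (⋃ j ∈ Mi, upPiece N η j) ⊆ D3 U ∩ Set.Ico (0 : ℝ) 1 := by
    refine Set.union_subset (Set.iUnion₂_subset fun j hj => ?_) (Set.iUnion₂_subset fun j hj => ?_)
    · have hj' := (Finset.mem_filter.1 hj).2
      exact Set.subset_inter (lowPiece_subset_D3 hU hP hη0 hS hj') (lowPiece_subset_Ico hη0 j)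
    · have hj' := (Finset.mem_filter.1 hj).2
      exact Set.subset_inter (upPiece_subset_D3 hU hP hη0 hS hj') (upPiece_subset_Ico hη0 j)
  calc ((d3plusCard S + d3minusCard S : ℕ) : ENNReal) * ENNReal.ofReal ((1 / 2 - 5 * η) / N)
      = ∑ j ∈ Pl, volume (lowPiece N η j) + ∑ j ∈ Mi, volume (upPiece N η j) := by
        rw [Finset.sum_congr rfl (fun j _ => volume_lowPiece η j), Finset.sum_congr rfl (fun j _ => volume_upPiece η j),
          Finset.sum_const, Finset.sum_const, nsmul_eq_mul, nsmul_eq_mul, ← add_mul, hcPl, hcMi]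
        push_cast
        rfl
    _ = volume (⋃ j ∈ Pl, lowPiece N η j) + volume (⋃ j ∈ Mi, upPiece N η j) := by
        rw [measure_biUnion_finset hdisjL (fun j _ => measurableSet_Ioo),
          measure_biUnion_finset hdisjU (fun j _ => measurableSet_Ioo)]
    _ = volume ((⋃ j ∈ Pl, lowPiece N η j) ∪ (⋃ j ∈ Mi, upPiece N η j)) :=
        (measure_union hdisj (Finset.measurableSet_biUnion _ fun j _ => measurableSet_Ioo)).symm
    _ ≤ volume (D3 U ∩ Set.Ico (0 : ℝ) 1) := measure_mono hsub

/-- monotonicity of the block count in `S`. -/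
theorem d3Cards_mono {S T : Finset (ZMod N)} (h : S ⊆ T) :
    d3plusCard S + d3minusCard S ≤ d3plusCard T + d3minusCard T := by
  have m0 : ∀ j, P0 S j → P0 T j := fun j ⟨s, hs, h1, h2⟩ => ⟨s, h hs, h h1, h h2⟩
  have m1 : ∀ j, P1 S j → P1 T j := fun j ⟨s, hs, h1, h2⟩ => ⟨s, h hs, h h1, h h2⟩
  have m2 : ∀ j, P2 S j → P2 T j := fun j ⟨s, hs, h1, h2⟩ => ⟨s, h hs, h h1, h h2⟩
  unfold d3plusCard d3minusCard
  refine add_le_add (Finset.card_le_card ?_) (Finset.card_le_card ?_)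
  · intro j hj
    simp only [Finset.mem_filter, Finset.mem_univ, true_and] at hj ⊢
    rcases hj with hj | hj | hj
    · exact Or.inl (m0 j hj)
    · exact Or.inr (Or.inl (m1 j hj))
    · exact Or.inr (Or.inr (m2 j hj))
  · intro j hj
    simp only [Finset.mem_filter, Finset.mem_univ, true_and] at hj ⊢
    rcases hj with hj | hj | hj
    · exact Or.inl (m1 j hj)
    · exact Or.inr (Or.inl (m2 j hj))
    · exact Or.inr (Or.inr (m0 _ hj))

end Residues
/-! ### AK.4 Lebesgue density along grid cells -/

/-- (cell parity-ideate p4, Sketch16 — helper; statement verbatim) -/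
theorem closedBall_cell {N : ℕ} (hN : 0 < N) (a : ℤ) :
    Metric.closedBall (((a : ℝ) + 1 / 2) / N) (1 / (2 * N)) = Set.Icc ((a : ℝ) / N) (((a : ℝ) + 1) / N) := by
  have hN' : (0 : ℝ) < N := Nat.cast_pos.2 hN
  rw [Real.closedBall_eq_Icc]
  congr 1
  · field_simp
    ring
  · field_simp
    ring

/-- (cell parity-ideate p4, Sketch16 — helper; statement verbatim) -/
theorem cell_subset_closedBall {N : ℕ} (hN : 0 < N) (a : ℤ) :
    cell N a ⊆ Metric.closedBall (((a : ℝ) + 1 / 2) / N) (1 / (2 * N)) := by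
  rw [closedBall_cell hN]
  exact Set.Ico_subset_Icc_self

/-- (cell parity-ideate p4, Sketch16 — helper; statement verbatim) -/
theorem volume_closedBall_cell {N : ℕ} (hN : 0 < N) (a : ℤ) :
    volume (Metric.closedBall (((a : ℝ) + 1 / 2) / N) (1 / (2 * N))) = volume (cell N a) := by
  rw [closedBall_cell hN, Real.volume_Icc, cell, Real.volume_Ico]

/-- (cell parity-ideate p4, Sketch16 — helper; statement verbatim) -/
theorem volume_inter_closedBall_cell (Γ : Set ℝ) {N : ℕ} (hN : 0 < N) (a : ℤ) :
    volume (Γ ∩ Metric.closedBall (((a : ℝ) + 1 / 2) / N) (1 / (2 * N))) = volume (Γ ∩ cell N a) := by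
  apply le_antisymm
  · calc volume (Γ ∩ Metric.closedBall (((a : ℝ) + 1 / 2) / N) (1 / (2 * N)))
        ≤ volume ((Γ ∩ cell N a) ∪ {((a : ℝ) + 1) / N}) := by
          refine measure_mono fun y hy => ?_
          rw [closedBall_cell hN] at hy
          rcases eq_or_lt_of_le hy.2.2 with h | h
          · exact Or.inr h
          · exact Or.inl ⟨hy.1, hy.2.1, h⟩
      _ ≤ volume (Γ ∩ cell N a) + volume ({((a : ℝ) + 1) / N} : Set ℝ) := measure_union_le _ _
      _ = volume (Γ ∩ cell N a) := by rw [Real.volume_singleton, add_zero]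
  · exact measure_mono (Set.inter_subset_inter_right _ (cell_subset_closedBall hN a))

/-- **Lebesgue density along grid cells**: for a.e. `x ∈ Γ`, the density of `Γ` in the `N`-cell containing `x` tends to `1`. -/
theorem ae_tendsto_cellDensity (Γ : Set ℝ) :
    ∀ᵐ x ∂volume.restrict Γ, Tendsto (fun N : ℕ => volume (Γ ∩ cell N ⌊(N : ℝ) * x⌋) /
      volume (cell N ⌊(N : ℝ) * x⌋)) atTop (𝓝 1) := by
  have h := IsUnifLocDoublingMeasure.ae_tendsto_measure_inter_div (volume : Measure ℝ) Γ 1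
  filter_upwards [h] with x hx
  have hδ : Tendsto (fun N : ℕ => (1 : ℝ) / (2 * N)) atTop (𝓝[>] 0) := by
    rw [tendsto_nhdsWithin_iff]
    refine ⟨?_, ?_⟩
    · have h1 := tendsto_const_div_atTop_nhds_zero_nat (1 / 2 : ℝ)
      refine h1.congr fun N => ?_
      rw [div_div]
    · filter_upwards [eventually_ge_atTop 1] with N hN
      have : (0 : ℝ) < N := by exact_mod_cast hN
      exact Set.mem_Ioi.2 (by positivity)
  have hmem : ∀ᶠ N : ℕ in atTop,
      x ∈ Metric.closedBall ((((⌊(N : ℝ) * x⌋ : ℤ) : ℝ) + 1 / 2) / N) (1 * (1 / (2 * N))) := by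
    filter_upwards [eventually_ge_atTop 1] with N hN
    rw [one_mul]
    exact cell_subset_closedBall (by omega) _ (floor_mem_cell (by omega) x)
  have hlim := hx (fun N : ℕ => ((((⌊(N : ℝ) * x⌋ : ℤ) : ℝ) + 1 / 2) / N)) (fun N : ℕ => (1 : ℝ) / (2 * N)) hδ hmem
  refine hlim.congr' ?_
  filter_upwards [eventually_ge_atTop 1] with N hN
  rw [volume_inter_closedBall_cell Γ (by omega), volume_closedBall_cell (by omega)]

/-- the part of `U ∩ [0,1)` whose `N`-cell is not yet `η`-dense. -/
def badSet (U : Set ℝ) (η : ℝ) (N : ℕ) : Set ℝ :=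
  {x : ℝ | x ∈ U ∩ Set.Ico (0 : ℝ) 1 ∧ volume (U ∩ cell N ⌊(N : ℝ) * x⌋) ≤ ENNReal.ofReal ((1 - η) / N)}

/-- (cell parity-ideate p4, Sketch16 — helper; statement verbatim) -/
theorem measurable_volume_inter_cell {U : Set ℝ} (N : ℕ) :
    Measurable fun x : ℝ => volume (U ∩ cell N ⌊(N : ℝ) * x⌋) := by
  have h1 : Measurable fun x : ℝ => ⌊(N : ℝ) * x⌋ := Int.measurable_floor.comp (measurable_const_mul _)
  have h2 : Measurable fun a : ℤ => volume (U ∩ cell N a) := measurable_of_countable _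
  exact h2.comp h1

/-- (cell parity-ideate p4, Sketch16 — helper; statement verbatim) -/
theorem measurableSet_badSet {U : Set ℝ} (hU : MeasurableSet U) (η : ℝ) (N : ℕ) :
    MeasurableSet (badSet U η N) :=
  (hU.inter measurableSet_Ico).inter (measurableSet_le (measurable_volume_inter_cell N) measurable_const)

/-- **the non-dense part is eventually small** (Lebesgue density + continuity of measure from above). -/
theorem badSet_eventually_small {U : Set ℝ} (hU : MeasurableSet U) {η : ℝ} (hη0 : 0 < η) (hη1 : η ≤ 1)
    {ε : ENNReal} (hε : 0 < ε) : ∃ n₀ : ℕ, ∀ N : ℕ, n₀ ≤ N → volume (badSet U η N) ≤ ε := by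
  set A : ℕ → Set ℝ := fun n => ⋃ N, ⋃ (_ : n ≤ N), badSet U η N with hA
  have hAmeas : ∀ n, MeasurableSet (A n) := fun n =>
    MeasurableSet.iUnion fun N => MeasurableSet.iUnion fun _ => measurableSet_badSet hU η N
  have hAanti : Antitone A := by
    intro m n hmn x hx
    simp only [hA, Set.mem_iUnion] at hx ⊢
    obtain ⟨N, hN, hx⟩ := hx
    exact ⟨N, hmn.trans hN, hx⟩
  have hAfin : volume (A 0) ≠ ⊤ := by
    refine ne_top_of_le_ne_top (b := volume (Set.Ico (0 : ℝ) 1)) (by simp [Real.volume_Ico]) (measure_mono ?_)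
    intro x hx
    simp only [hA, Set.mem_iUnion] at hx
    obtain ⟨N, -, hx⟩ := hx
    exact hx.1.2
  have hnull : volume (⋂ n, A n) = 0 := by
    have hae := ae_tendsto_cellDensity U
    rw [ae_restrict_iff' hU] at hae
    refine measure_mono_null ?_ (ae_iff.1 hae)
    intro x hx
    simp only [Set.mem_iInter, hA, Set.mem_iUnion] at hx
    simp only [Set.mem_setOf_eq, Classical.not_imp]
    obtain ⟨N0, -, hx0⟩ := hx 0
    refine ⟨hx0.1.1, fun hT => ?_⟩
    have hev : ∀ᶠ N : ℕ in atTop, ENNReal.ofReal (1 - η) <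
        volume (U ∩ cell N ⌊(N : ℝ) * x⌋) / volume (cell N ⌊(N : ℝ) * x⌋) :=
      hT.eventually (Ioi_mem_nhds (by
        rw [← ENNReal.ofReal_one]
        exact (ENNReal.ofReal_lt_ofReal_iff one_pos).2 (by linarith)))
    obtain ⟨n₁, hn₁⟩ := eventually_atTop.1 hev
    obtain ⟨N, hN, hxN⟩ := hx (max n₁ 1)
    have hN1 : 0 < N := lt_of_lt_of_le (by omega) (le_of_max_le_right hN)
    have hN' : (0 : ℝ) < N := Nat.cast_pos.2 hN1
    have h1 := hn₁ N (le_of_max_le_left hN)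
    have h2 := hxN.2
    rw [volume_cell hN1] at h1
    rw [ENNReal.lt_div_iff_mul_lt (Or.inl (ENNReal.ofReal_pos.2 (by positivity)).ne') (Or.inl ENNReal.ofReal_ne_top),
      ← ENNReal.ofReal_mul (by linarith)] at h1
    have ee : (1 - η) * (1 / (N : ℝ)) = (1 - η) / N := by ring
    rw [ee] at h1
    exact lt_irrefl _ (h1.trans_le h2)
  have htend : Tendsto (fun n => volume (A n)) atTop (𝓝 0) := by
    have := tendsto_measure_iInter_atTop (μ := volume) (fun n => (hAmeas n).nullMeasurableSet) hAanti ⟨0, hAfin⟩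
    rw [hnull] at this
    exact this
  obtain ⟨n₀, hn₀⟩ := eventually_atTop.1 (htend.eventually (Iio_mem_nhds hε))
  refine ⟨n₀, fun N hN => ?_⟩
  calc volume (badSet U η N) ≤ volume (A N) := measure_mono fun x hx => by
          simp only [hA, Set.mem_iUnion]
          exact ⟨N, le_rfl, hx⟩
    _ ≤ ε := (hn₀ N hN).le

/-- **counting the dense cells**: `μ(U ∩ [0,1)) ≤ μ(bad) + |S|/N` whenever `S` contains every dense residue. -/
theorem volume_le_badSet_add_card {U : Set ℝ} (hP : Periodic1 U) {N : ℕ} [NeZero N] (η : ℝ)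
    (S : Finset (ZMod N)) (hS : ∀ s : ZMod N, CellDense U N η (s.val : ℤ) → s ∈ S) :
    volume (U ∩ Set.Ico (0 : ℝ) 1) ≤ volume (badSet U η N) + (S.card : ENNReal) * ENNReal.ofReal (1 / N) := by
  have hN : 0 < N := Nat.pos_of_ne_zero (NeZero.ne N)
  have hN' : (0 : ℝ) < N := Nat.cast_pos.2 hN
  have hcov : U ∩ Set.Ico (0 : ℝ) 1 ⊆ badSet U η N ∪ ⋃ s ∈ S, cell N (s.val : ℤ) := by
    intro x hx
    by_cases hb : volume (U ∩ cell N ⌊(N : ℝ) * x⌋) ≤ ENNReal.ofReal ((1 - η) / N)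
    · exact Or.inl ⟨hx, hb⟩
    · right
      push Not at hb
      have hm0 : 0 ≤ ⌊(N : ℝ) * x⌋ := Int.floor_nonneg.2 (mul_nonneg hN'.le hx.2.1)
      have hmN : ⌊(N : ℝ) * x⌋ < (N : ℤ) := Int.floor_lt.2 (by
        push_cast
        exact mul_lt_of_lt_one_right hN' hx.2.2)
      have hdense : CellDense U N η ⌊(N : ℝ) * x⌋ := hb
      have hs : ((⌊(N : ℝ) * x⌋ : ℤ) : ZMod N) ∈ S :=
        hS _ ((cellDense_iff_of_cast_eq hP hN η rfl).1 hdense)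
      have hval : ((((⌊(N : ℝ) * x⌋ : ℤ) : ZMod N).val : ℤ)) = ⌊(N : ℝ) * x⌋ := by
        rw [ZMod.val_intCast, Int.emod_eq_of_lt hm0 hmN]
      simp only [Set.mem_iUnion]
      exact ⟨_, hs, by rw [hval]; exact floor_mem_cell hN x⟩
  calc volume (U ∩ Set.Ico (0 : ℝ) 1) ≤ volume (badSet U η N ∪ ⋃ s ∈ S, cell N (s.val : ℤ)) := measure_mono hcov
    _ ≤ volume (badSet U η N) + volume (⋃ s ∈ S, cell N (s.val : ℤ)) := measure_union_le _ _
    _ ≤ volume (badSet U η N) + ∑ s ∈ S, volume (cell N (s.val : ℤ)) := by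
        gcongr
        exact measure_biUnion_finset_le _ _
    _ = volume (badSet U η N) + (S.card : ENNReal) * ENNReal.ofReal (1 / N) := by
        rw [Finset.sum_congr rfl (fun s _ => volume_cell hN (s.val : ℤ)), Finset.sum_const, nsmul_eq_mul]

end Summit.Parity.GeneralizedHardyLittlewood.Theorems.PrimeGapTorusCap
/-! ### AK.5 the combinatorial LEFT PROFILE statement and the transfer theorem -/

namespace Summit.Parity.GeneralizedHardyLittlewood.Theorems.PrimeGapTorusCap.NearAP
/-- `(Δ_lin)_ℤ` at the single modulus `N = n + 1`.  The transfer theorem below only needs it for INFINITELY MANY `N`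
(`∃ᶠ n in atTop, ConjLinZAt n`), e.g. along the primes or the powers of two. -/
def ConjLinZAt (n : ℕ) : Prop :=
  ∀ S : Finset (ZMod (n + 1)), 2 * (n + 1) ≤ 5 * S.card → 2 * S.card ≤ n + 1 →
    2 * S.card ≤ d3plusCard S + d3minusCard S

end Summit.Parity.GeneralizedHardyLittlewood.Theorems.PrimeGapTorusCap.NearAP
namespace Summit.Parity.GeneralizedHardyLittlewood.Theorems.PrimeGapTorusCap
open MeasureTheory Set Filter Topology NearAP
end Summit.Parity.GeneralizedHardyLittlewood.Theorems.PrimeGapTorusCap
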